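import Literature.AlgebraicGeometry.HodgeTheory.WeilClassesCyclicPrymDegreeSevenTyping
import Literature.AlgebraicGeometry.HodgeTheory.WeilClassesCyclicPrymLefschetz
import HarnessLib

/-!
# Schoen's cyclic Prym fact in degree `7`: the Chevalley–Weil multiplicity `12` from `H¹(J) ≅ H¹(C)`

Topic `AlgebraicGeometry/HodgeTheory`; namespace `Literature.AlgebraicGeometry.HodgeTheory`.
Second theorem-only companion (no definition, no named fact, sorry-free) of the named fact
`Schoen1988_cyclicPrym_weilClasses_algebraic_degreeSeven` (`WeilClassesCyclicPrymDegreeSeven.lean`;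
Schoen 1988, Cor. 3.1 with Thm. 2.0 at `(q, m, r) = (7, 7, 0)` = Patel–Zhang 2025, Thm. 1.2 / 5.3
with Lemma 5.1).  The first companion (`WeilClassesCyclicPrymDegreeSevenTyping`) reduced the fact to
(P2) `dim Eig(s_B^*|H¹(B(ℂ); ℂ), ζ₇^a) ≤ 12` and (P3) Schoen's cycles.  This file ELIMINATES (P2) in
favour of the single named fact `Motives.isIso_bettiCohomology_map_abelJacobi` (`H¹(J(C)) ≅ H¹(C)`,
Lange §4.1.1), exactly as `WeilClassesCyclicPrymLefschetz` / `…DegreeThree` did in degrees `6`, `3` —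
and PROVES the multiplicity statement of Patel–Zhang Lemma 2.9 / Cor. 2.10 / Lemma 5.1 for the
Prym of an étale `ℤ/7`-cover in the tree's language:

* §1 (linear algebra) `finrank_ker_sum_pow_add_finrank_ker_sub_one` (`S⁷ = 1 ⟹
  V = ker(S - 1) ⊕ ker(1 + S + ⋯ + S⁶)`) and **`six_mul_finrank_eigenspace_eq_of_cyclotomic₇`**: if
  `Φ₇(T) = Σ_{j<7} Tʲ = 0` on a finite-dimensional `ℂ`-space `V` and `tr T ∈ ℚ`, then EVERY
  primitive 7th root of unity `ζ^a` (`1 ≤ a ≤ 6`) has multiplicity `dim V / 6` — the character of a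
  rational representation of `ℤ/7` is Galois-invariant (`1, ζ, …, ζ⁵` are `ℚ`-linearly independent,
  Mathlib `linearIndependent_pow` with `minpoly_ℚ ζ = Φ₇`).  This replaces, for the prime `7`, the
  complex-conjugation symmetry that sufficed for the quadratic fields `ℚ(ζ₃) = ℚ(ζ₆)`.
* §2 (the curve) `seven_mul_finrank_ker_sub_one_eq`: for a free automorphism `σ` of order `7` of a
  smooth projective complex curve, `7 · dim H¹(C(ℂ); ℂ)^σ = 12 + b₁(C)` — Smith theory and the transfer
  on the closed surface `C(ℂ)` (`OrbitSpace.euler_eq_prime_mul_euler`: `χ(C) = 7 χ(C/σ)`;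
  `OrbitSpace.finrank_cohomology_orbitSpace_eq`: `H^k(C/σ) = H^k(C)^σ`; `σ^* = 1` on `H⁰` and on
  `H²`, the latter because its trace is a rational 7th root of unity), i.e. `g(C/σ) = 7` when
  `g(C) = 43` (Riemann–Hurwitz for the étale cover; Patel–Zhang Lemma 2.9: `χ(C', L_χ) = 2 - 2g'`).
* §3 (the Jacobian) **`dim_kerComponent_normElement_eq_thirtySix_of_isIso`**: `dim B = 36` for
  `B = (ker Σ_{i<7} σ_*ⁱ)⁰ ⊂ J(C)`, `dim J(C) = 43` (Patel–Zhang Lemma 5.1: `(m-1)(g(C')-1) = 6·6`),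
  from `isIso_bettiCohomology_map_abelJacobi`: `2 dim B = dim ker(Σ Sʲ | H¹(J))`
  (`two_mul_dim_kerComponent_eq_finrank_ker`) `= 86 - dim ker(S - 1) = 86 - 14`, `S = (σ_*)^*` being
  conjugate to `σ^*` by `(f^P)^*`.
* §4 (the Prym) **`finrank_eigenspace_kerComponent_restrict_eq_twelve_of_isIso`**: each of the six
  eigenspaces `H¹(B(ℂ); ℂ)_{ζ₇^a}` of `s_B^*` has dimension EXACTLY `12` (`Φ₇(s_B) = 0`, the trace of
  `s_B^*` is rational — `trace_map_one_mem_range_ratCast` — and `b₁(B) = 2 dim B = 72`).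
* §5 **`Schoen1988_cyclicPrym_weilClasses_algebraic_degreeSeven_of_isIso_of_exists_three`**: the fact
  from (i) `isIso_bettiCohomology_map_abelJacobi` and (iii) ONE non-zero algebraic class in each of
  `E₁, E₂, E₃` — Schoen's cycles `z_χ` (Thm. 2.0, `r = 0`; Cor. 3.1), the part of the printed proof
  the tree does not have (symmetric powers, the Abel–Jacobi `ℙ⁶`-bundle over `Pic¹²`, `c₆(N) ≠ 0`,
  Poincaré's formula, Lieberman).  With (i) the typed eigenspaces `E_a` are honest LINES
  (`finrank_eigenspace_two_add_pow_twelve_eq_one_of_isIso`).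

## References

* [Schoen1988HodgeWeil] C. Schoen, Compositio Math. 65 (1988): Lemma 1.5 (p. 7), Thm. 2.0 (p. 11,
  proof p. 13), §3 Cor. 3.1 (pp. 24–25).
* [PatelZhang2025PrymHodge] D. Patel, Y. Zhang, arXiv:2506.13729 (2025): Lemma 2.9, Cor. 2.10, §2.6,
  Lemma 5.1, Thm. 5.3.
* [Lange2023AbelianVarietiesC] H. Lange (2023), §4.1.1, Lemma 4.4.1, §4.5.2.
* [Bredon1972] G. E. Bredon, Introduction to Compact Transformation Groups (1972), Ch. III Thm. 7.10.
* [HatcherAT2002] A. Hatcher, Algebraic Topology (2002), §3.G Prop. 3G.1.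
* [SerreLinearRepresentations1977] J.-P. Serre, Linear Representations of Finite Groups, §2.3, §12.1.
-/

noncomputable section

open CategoryTheory Polynomial

namespace Literature.AlgebraicGeometry.HodgeTheory

open Literature.AlgebraicTopology.SingularHomology
open Literature.AlgebraicGeometry Literature.AlgebraicGeometry.Motives

universe u

/-! ### §1 Linear algebra: `ker(S - 1) ⊕ ker Φ₇(S)`, and equal multiplicities from a rational trace -/

section LinearAlgebra

variable {V : Type*} [AddCommGroup V] [Module ℂ V]

/-- `(X - 1)` and `1 + X + ⋯ + X⁶` are coprime in `ℂ[X]`: Bézout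
`(1 + X + ⋯ + X⁶) - (X - 1)(X⁵ + 2X⁴ + 3X³ + 4X² + 5X + 6) = 7`. [folklore] -/
theorem isCoprime_X_sub_one_sum_range_seven_pow :
    IsCoprime (X - 1 : ℂ[X]) (∑ j ∈ Finset.range 7, X ^ j) := by
  have key : (∑ j ∈ Finset.range 7, (X : ℂ[X]) ^ j) -
      (X - 1) * (X ^ 5 + 2 * X ^ 4 + 3 * X ^ 3 + 4 * X ^ 2 + 5 * X + 6) = C 7 := by
    simp only [Finset.sum_range_succ, Finset.sum_range_zero, map_ofNat]
    ring
  refine ⟨-(C (7 : ℂ)⁻¹ * (X ^ 5 + 2 * X ^ 4 + 3 * X ^ 3 + 4 * X ^ 2 + 5 * X + 6)), C (7 : ℂ)⁻¹, ?_⟩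
  calc -(C (7 : ℂ)⁻¹ * (X ^ 5 + 2 * X ^ 4 + 3 * X ^ 3 + 4 * X ^ 2 + 5 * X + 6)) * (X - 1) +
        C (7 : ℂ)⁻¹ * ∑ j ∈ Finset.range 7, X ^ j
      = C (7 : ℂ)⁻¹ * ((∑ j ∈ Finset.range 7, (X : ℂ[X]) ^ j) -
          (X - 1) * (X ^ 5 + 2 * X ^ 4 + 3 * X ^ 3 + 4 * X ^ 2 + 5 * X + 6)) := by ring
    _ = 1 := by rw [key, ← C_mul, inv_mul_cancel₀ (by norm_num), C_1]

/-- **`V = ker(S - 1) ⊕ ker(1 + S + ⋯ + S⁶)` for `S⁷ = 1`** on a finite-dimensional `ℂ`-space: the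
two kernels are complementary (`(X - 1)·Φ₇ = X⁷ - 1` with coprime factors; Mathlib
`Polynomial.sup_ker_aeval_eq_ker_aeval_mul_of_coprime`, `disjoint_ker_aeval_of_isCoprime`), so
their dimensions add up to `dim V`. [folklore] -/
theorem finrank_ker_sum_pow_add_finrank_ker_sub_one [FiniteDimensional ℂ V] (S : Module.End ℂ V)
    (hS : S ^ 7 = 1) :
    Module.finrank ℂ (LinearMap.ker (∑ j ∈ Finset.range 7, S ^ j)) +
      Module.finrank ℂ (LinearMap.ker (S - 1)) = Module.finrank ℂ V := by
  have hp : aeval S (X - 1 : ℂ[X]) = S - 1 := by simp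
  have hq : aeval S (∑ j ∈ Finset.range 7, X ^ j : ℂ[X]) = ∑ j ∈ Finset.range 7, S ^ j := by
    simp [map_sum]
  have hpq : aeval S ((X - 1 : ℂ[X]) * ∑ j ∈ Finset.range 7, X ^ j) = 0 := by
    rw [mul_comm, geom_sum_mul, map_sub, map_pow, aeval_X, map_one, hS, sub_self]
  have hcop := isCoprime_X_sub_one_sum_range_seven_pow
  have hsup := Polynomial.sup_ker_aeval_eq_ker_aeval_mul_of_coprime S hcop
  have hdis := Polynomial.disjoint_ker_aeval_of_isCoprime S hcop
  rw [hpq, LinearMap.ker_zero, hp, hq] at hsup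
  rw [hp, hq] at hdis
  have h := Submodule.finrank_sup_add_finrank_inf_eq (LinearMap.ker (S - 1))
    (LinearMap.ker (∑ j ∈ Finset.range 7, S ^ j))
  rw [hsup, disjoint_iff.mp hdis, finrank_top, finrank_bot, add_zero] at h
  omega

/-- `Φ₇(T) = 1 + T + ⋯ + T⁶ = 0 ⟹ T⁷ = 1` (`(Σ_{j<7} Tʲ)(T - 1) = T⁷ - 1`). [folklore] -/
theorem pow_seven_eq_one_of_sum_range_pow_eq_zero {R : Type*} [Ring R] {T : R}
    (hΦ : ∑ j ∈ Finset.range 7, T ^ j = 0) : T ^ 7 = 1 := by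
  have h := geom_sum_mul T 7
  rw [hΦ, zero_mul] at h
  exact sub_eq_zero.mp h.symm

/-- `Φ₇(T) = 0 ⟹ 1` is not an eigenvalue of `T` (on a fixed vector `Φ₇(T)` is multiplication by `7`).
[folklore] -/
theorem eigenspace_one_eq_bot_of_sum_range_pow_eq_zero (T : Module.End ℂ V)
    (hΦ : ∑ j ∈ Finset.range 7, T ^ j = 0) : T.eigenspace 1 = ⊥ := by
  rw [Submodule.eq_bot_iff]
  intro v hv
  have hfix : ∀ j : ℕ, (T ^ j) v = v := fun j => by
    rw [pow_apply_of_mem_eigenspace hv, one_pow, one_smul]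
  have h7v : (∑ j ∈ Finset.range 7, T ^ j) v = 7 • v := by
    rw [LinearMap.sum_apply, Finset.sum_congr rfl (fun j _ => hfix j), Finset.sum_const,
      Finset.card_range]
  rw [hΦ, LinearMap.zero_apply, ← Nat.cast_smul_eq_nsmul ℂ] at h7v
  exact (smul_eq_zero.mp h7v.symm).resolve_left (by norm_num)

/-- `1, ζ, …, ζ⁵` are linearly independent over `ℚ` for a primitive 7th root of unity `ζ ∈ ℂ`
(`minpoly_ℚ ζ = Φ₇` has degree `6`; Mathlib `linearIndependent_pow`). [folklore] -/
theorem linearIndependent_pow_of_isPrimitiveRoot_seven {ζ : ℂ} (hζ : IsPrimitiveRoot ζ 7) :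
    LinearIndependent ℚ (fun i : Fin 6 => ζ ^ (i : ℕ)) := by
  have h := linearIndependent_pow (K := ℚ) ζ
  have hdeg : (minpoly ℚ ζ).natDegree = 6 := by
    rw [← Polynomial.cyclotomic_eq_minpoly_rat hζ (by norm_num), Polynomial.natDegree_cyclotomic]
    decide
  rw [hdeg] at h
  exact h

/-- **Galois symmetry of a rational character of `ℤ/7`.** If non-negative integers `m₀, …, m₆` with
`m₀ = 0` satisfy `Σ_{i<7} mᵢ ζⁱ ∈ ℚ` for a primitive 7th root of unity `ζ`, then `m₁ = ⋯ = m₆`: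
substitute `ζ⁶ = -(1 + ζ + ⋯ + ζ⁵)` and use the `ℚ`-linear independence of `1, ζ, …, ζ⁵`.  (The
character of a RATIONAL representation takes the same value on all generators of `ℤ/7`; Serre §12.1.)
[cite: SerreLinearRepresentations1977, §12.1] -/
theorem eq_of_sum_mul_pow_eq_ratCast {ζ : ℂ} (hζ : IsPrimitiveRoot ζ 7) (m : ℕ → ℕ) (hm0 : m 0 = 0)
    (q : ℚ) (hq : ∑ i ∈ Finset.range 7, (m i : ℂ) * ζ ^ i = q) :
    ∀ a, 1 ≤ a → a ≤ 6 → m a = m 6 := by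
  have hgeom : ∑ i ∈ Finset.range 7, ζ ^ i = 0 := hζ.geom_sum_eq_zero (by norm_num)
  have hli := linearIndependent_pow_of_isPrimitiveRoot_seven hζ
  rw [Fintype.linearIndependent_iff] at hli
  -- the coefficient vector of the vanishing `ℚ`-combination of `1, ζ, …, ζ⁵`
  set g : Fin 6 → ℚ := Fin.cons ((m 0 : ℚ) - m 6 - q) (fun i : Fin 5 => (m ((i : ℕ) + 1) : ℚ) - m 6)
    with hg
  have hfin : ∑ i : Fin 6, g i • ζ ^ (i : ℕ) = 0 := by
    rw [Fin.sum_univ_succ]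
    simp only [hg, Fin.cons_zero, Fin.cons_succ, Fin.val_zero, Fin.val_succ, pow_zero]
    rw [Fin.sum_univ_eq_sum_range (fun i => ((m (i + 1) : ℚ) - m 6 : ℚ) • ζ ^ (i + 1)) 5]
    simp only [Finset.sum_range_succ, Finset.sum_range_zero, zero_add, Rat.smul_def] at hq hgeom ⊢
    rw [hm0] at hq ⊢
    push_cast at hq ⊢
    linear_combination hq - (m 6 : ℂ) * hgeom
  have hzero := hli g hfin
  intro a ha₁ ha₆
  rcases Nat.lt_or_ge a 6 with hlt | hge
  · have h := hzero ⟨a, hlt⟩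
    have hsucc : (⟨a, hlt⟩ : Fin 6) = Fin.succ ⟨a - 1, by omega⟩ :=
      Fin.ext (by simp only [Fin.val_succ]; omega)
    rw [hsucc, hg, Fin.cons_succ] at h
    simp only [Nat.sub_add_cancel ha₁, sub_eq_zero, Nat.cast_inj] at h
    exact h
  · have : a = 6 := le_antisymm ha₆ hge
    rw [this]

/-- **Equal multiplicities of the primitive 7th roots of unity** (Patel–Zhang Lemma 2.9 / Cor. 2.10 in
linear-algebra form).  Let `T` be an endomorphism of a finite-dimensional `ℂ`-space `V` with
`Φ₇(T) = 1 + T + ⋯ + T⁶ = 0` and RATIONAL trace.  Then for every `1 ≤ a ≤ 6` the `ζ^a`-eigenspace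
has dimension `dim V / 6`: `T` is diagonalisable with eigenvalues among `ζ, …, ζ⁶` (`1` is excluded by
`Φ₇(T) = 0`), `tr T = Σ_a m_a ζ^a` with `m_a` the multiplicities, and a rational value forces
`m₁ = ⋯ = m₆` (`eq_of_sum_mul_pow_eq_ratCast`). [cite: PatelZhang2025PrymHodge, Lemma 2.9 and Cor. 2.10]
[cite: SerreLinearRepresentations1977, §2.3 and §12.1] -/
theorem six_mul_finrank_eigenspace_eq_of_cyclotomic₇ [FiniteDimensional ℂ V] (T : Module.End ℂ V)
    (hΦ : ∑ j ∈ Finset.range 7, T ^ j = 0)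
    (htr : LinearMap.trace ℂ V T ∈ Set.range ((↑) : ℚ → ℂ)) {ζ : ℂ} (hζ : IsPrimitiveRoot ζ 7)
    {a : ℕ} (ha₁ : 1 ≤ a) (ha₆ : a ≤ 6) :
    6 * Module.finrank ℂ (T.eigenspace (ζ ^ a)) = Module.finrank ℂ V := by
  classical
  have hT7 : T ^ 7 = 1 := pow_seven_eq_one_of_sum_range_pow_eq_zero hΦ
  -- the seven candidate eigenspaces form an internal direct sum decomposition of `V`
  set E : Fin 7 → Submodule ℂ V := fun b => T.eigenspace (ζ ^ (b : ℕ)) with hE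
  have hinj : Function.Injective fun b : Fin 7 => ζ ^ (b : ℕ) := fun b b' h =>
    Fin.ext (hζ.pow_inj b.2 b'.2 h)
  have hind : iSupIndep E := T.eigenspaces_iSupIndep.comp hinj
  have hss : T.IsSemisimple := by
    refine Module.End.isSemisimple_of_squarefree_aeval_eq_zero
      (Polynomial.separable_X_pow_sub_C (1 : ℂ) (n := 7) (by norm_num) one_ne_zero).squarefree ?_
    simp only [map_sub, map_pow, aeval_X, map_one, hT7, sub_self]
  have htop : ⨆ μ, T.eigenspace μ = ⊤ := hss.iSup_eigenspace_eq_top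
  have hle : ∀ μ, T.eigenspace μ ≤ ⨆ b, E b := by
    intro μ
    by_cases hμ : T.eigenspace μ = ⊥
    · rw [hμ]; exact bot_le
    · obtain ⟨v, hv, hv0⟩ := Submodule.exists_mem_ne_zero_of_ne_bot hμ
      obtain ⟨i, hi, rfl⟩ := hζ.eq_pow_of_pow_eq_one (pow_eq_one_of_mem_eigenspace hT7 hv hv0)
      exact le_iSup E ⟨i, hi⟩
  have htop' : ⨆ b, E b = ⊤ := top_le_iff.mp (htop ▸ iSup_le hle)
  have hint : DirectSum.IsInternal E :=
    DirectSum.isInternal_submodule_of_iSupIndep_of_iSup_eq_top hind htop'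
  -- multiplicities `m i = dim Eig(T, ζⁱ)` and an adapted basis
  set m : ℕ → ℕ := fun i => Module.finrank ℂ (T.eigenspace (ζ ^ i)) with hm
  let bB := hint.collectedBasis fun b => Module.finBasis ℂ (E b)
  have hdim : Module.finrank ℂ V = ∑ i ∈ Finset.range 7, m i := by
    rw [Module.finrank_eq_card_basis bB, Fintype.card_sigma, Finset.sum_range]
    simp only [Fintype.card_fin]
    rfl
  have htrace : LinearMap.trace ℂ V T = ∑ i ∈ Finset.range 7, (m i : ℂ) * ζ ^ i := by
    rw [LinearMap.trace_eq_matrix_trace ℂ bB, Matrix.trace]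
    have hTb : ∀ x : Σ b : Fin 7, Fin (Module.finrank ℂ (E b)), T (bB x) = ζ ^ ((x.1 : Fin 7) : ℕ) • bB x :=
      fun x => Module.End.mem_eigenspace_iff.mp (hint.collectedBasis_mem _ x)
    simp only [Matrix.diag_apply, LinearMap.toMatrix_apply, hTb, map_smul, Module.Basis.repr_self,
      Finsupp.smul_apply, Finsupp.single_eq_same, smul_eq_mul, mul_one]
    rw [Fintype.sum_sigma, Finset.sum_range]
    simp only [Finset.sum_const, Finset.card_univ, Fintype.card_fin, nsmul_eq_mul]
    rfl
  have hm0 : m 0 = 0 := by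
    change Module.finrank ℂ (T.eigenspace (ζ ^ 0)) = 0
    rw [pow_zero, eigenspace_one_eq_bot_of_sum_range_pow_eq_zero T hΦ, finrank_bot]
  -- rationality of the trace and the Galois symmetry
  obtain ⟨q, hq⟩ := htr
  rw [htrace] at hq
  have heq := eq_of_sum_mul_pow_eq_ratCast hζ m hm0 q hq.symm
  have ha : m a = m 6 := heq a ha₁ ha₆
  change 6 * m a = _
  rw [hdim]
  simp only [Finset.sum_range_succ, Finset.sum_range_zero, zero_add, hm0, heq 1 le_rfl (by norm_num),
    heq 2 (by norm_num) (by norm_num), heq 3 (by norm_num) (by norm_num),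
    heq 4 (by norm_num) (by norm_num), heq 5 (by norm_num) (by norm_num), ha]
  ring

end LinearAlgebra

/-! ### §2 The curve: `7 · dim H¹(C(ℂ); ℂ)^σ = 12 + b₁(C)` for a free `σ` of order `7` -/

section Curve

variable {C : Motives.SchemeOver ℂ}

/-- **`σ^* = 1` on the line `H²(C(ℂ); ℂ)`** for an automorphism `σ` with `σ⁷ = 𝟙` of a smooth
projective curve: the trace `l` of `σ^*` on `H²` is rational (`trace_complexBetti_map_mem_range_ratCast`)
with `l⁷ = 1`, hence `l = 1`, and an endomorphism of a line is its trace. [folklore] -/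
theorem complexBetti_map_two_hom_eq_one_of_pow_seven (hC : Motives.IsSmoothProjective 1 C) (σ : C ⟶ C)
    (hσ : σ ≫ σ ≫ σ ≫ σ ≫ σ ≫ σ ≫ σ = 𝟙 C) : (complexBetti.map σ 2).hom = 1 := by
  haveI := finite_complexBetti_of_isSmoothProjective hC 2
  have h1 := finrank_complexBetti_two_of_curve hC
  set l := LinearMap.trace ℂ _ (complexBetti.map σ 2).hom with hl
  have h7 : l ^ 7 = 1 := by
    rw [hl, ← trace_pow_of_finrank_eq_one h1]
    have e : (complexBetti.map σ 2).hom ^ 7 = (complexBetti.map (σ ≫ σ ≫ σ ≫ σ ≫ σ ≫ σ ≫ σ) 2).hom := by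
      simp only [complexBetti_map_comp_hom', pow_succ, pow_zero, Module.End.one_eq_id,
        LinearMap.id_comp, Module.End.mul_eq_comp, LinearMap.comp_assoc]
    rw [e, hσ, complexBetti.map_id, ModuleCat.hom_id, ← Module.End.one_eq_id, LinearMap.trace_one, h1,
      Nat.cast_one]
  obtain ⟨r, hr⟩ := trace_complexBetti_map_mem_range_ratCast hC σ 2
  rw [← hl] at hr
  have hr7 : r ^ 7 = 1 := by exact_mod_cast (show ((r : ℂ)) ^ 7 = 1 by rw [hr, h7])
  have hr1 : r = 1 := (Odd.strictMono_pow (by decide : Odd 7)).injective (by rw [hr7, one_pow])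
  have hl1 : l = 1 := by rw [← hr, hr1, Rat.cast_one]
  rw [eq_trace_smul_one_of_finrank_eq_one h1 (complexBetti.map σ 2).hom, ← hl, hl1, one_smul]

/-- **Riemann–Hurwitz for the étale `ℤ/7`-quotient, cohomologically**: for a smooth projective complex
curve `C` and an automorphism `σ` with `σ⁷ = 𝟙` without fixed complex points,
`7 · dim ker(σ^* - 1 | H¹(C(ℂ); ℂ)) = 12 + dim H¹(C(ℂ); ℂ)` (for `g(C) = 43`: `dim H¹(C)^σ = 14 =
b₁(C/σ)`, `g(C/σ) = 7`).  Proof on the closed surface `C(ℂ)`: `χ(C) = 7·χ(C/⟨σ⟩)` (Smith theory,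
`OrbitSpace.euler_eq_prime_mul_euler`) and `H^k(C/⟨σ⟩; ℂ) = H^k(C; ℂ)^σ` (transfer,
`OrbitSpace.finrank_cohomology_orbitSpace_eq`), with `σ^* = 1` on `H⁰` and `H²`.  (Patel–Zhang
Lemma 2.9: "`χ_top(C', L_χ) = χ_top(C') = 2 - 2g`".) [cite: PatelZhang2025PrymHodge, Lemma 2.9]
[cite: Bredon1972, Ch. III Thm. 7.10] [cite: HatcherAT2002, §3.G Prop. 3G.1] -/
theorem seven_mul_finrank_ker_sub_one_eq (hC : Motives.IsSmoothProjective 1 C) (σ : C ⟶ C)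
    (hσ : σ ≫ σ ≫ σ ≫ σ ≫ σ ≫ σ ≫ σ = 𝟙 C) (hfree : ∀ P : Motives.ComplexPoints C, P ≫ σ ≠ P) :
    7 * Module.finrank ℂ (LinearMap.ker ((complexBetti.map σ 1).hom - 1)) =
      12 + Module.finrank ℂ (complexBetti C 1) := by
  letI := hC.chartedSpace
  haveI := Motives.ComplexPoints.compactSpace_of_isSmoothProjective hC
  haveI := Motives.ComplexPoints.t2Space_of_isSmoothProjective hC
  haveI : Nonempty (Motives.ComplexPoints C) := Motives.nonempty_algPoints_of_isSmoothProjective hC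
  haveI : Fact (Nat.Prime 7) := ⟨by norm_num⟩
  haveI h0fin := finite_complexBetti_of_isSmoothProjective hC 0
  haveI h1fin := finite_complexBetti_of_isSmoothProjective hC 1
  haveI h2fin := finite_complexBetti_of_isSmoothProjective hC 2
  -- the homeomorphism `a = σ(ℂ)` of the closed surface `C(ℂ)`, of order `7`, acting freely
  let a : Motives.ComplexPoints C ≃ₜ Motives.ComplexPoints C :=
    { toFun := Motives.AlgPoints.mapContinuous (L := ℂ) σ
      invFun := Motives.AlgPoints.mapContinuous (L := ℂ) (σ ≫ σ ≫ σ ≫ σ ≫ σ ≫ σ)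
      left_inv := fun x => by
        change Motives.AlgPoints.map (σ ≫ σ ≫ σ ≫ σ ≫ σ ≫ σ) (Motives.AlgPoints.map σ x) = x
        rw [← Motives.AlgPoints.map_comp_apply, hσ, Motives.AlgPoints.map_id_apply]
      right_inv := fun x => by
        change Motives.AlgPoints.map σ (Motives.AlgPoints.map (σ ≫ σ ≫ σ ≫ σ ≫ σ ≫ σ) x) = x
        rw [← Motives.AlgPoints.map_comp_apply]
        simp only [Category.assoc]
        rw [hσ, Motives.AlgPoints.map_id_apply]
      continuous_toFun := (Motives.AlgPoints.mapContinuous (L := ℂ) σ).continuous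
      continuous_invFun :=
        (Motives.AlgPoints.mapContinuous (L := ℂ) (σ ≫ σ ≫ σ ≫ σ ≫ σ ≫ σ)).continuous }
  have hpow : ∀ (k : ℕ) (β : C ⟶ C),
      (∀ y : Motives.ComplexPoints C, Motives.AlgPoints.map β y = (a ^ k) y) →
      ∀ x : Motives.ComplexPoints C, (a ^ (k + 1)) x = Motives.AlgPoints.map (σ ≫ β) x := by
    intro k β hβ x
    rw [pow_succ, Homeomorph.mul_apply, Motives.AlgPoints.map_comp_apply, hβ]
    rfl
  have ha1 : ∀ x, (a ^ 1) x = Motives.AlgPoints.map σ x := fun x => by rw [pow_one]; rfl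
  have ha2 : ∀ x, (a ^ 2) x = Motives.AlgPoints.map (σ ≫ σ) x := hpow 1 σ fun y => (ha1 y).symm
  have ha3 : ∀ x, (a ^ 3) x = Motives.AlgPoints.map (σ ≫ σ ≫ σ) x :=
    hpow 2 (σ ≫ σ) fun y => (ha2 y).symm
  have ha4 : ∀ x, (a ^ 4) x = Motives.AlgPoints.map (σ ≫ σ ≫ σ ≫ σ) x :=
    hpow 3 (σ ≫ σ ≫ σ) fun y => (ha3 y).symm
  have ha5 : ∀ x, (a ^ 5) x = Motives.AlgPoints.map (σ ≫ σ ≫ σ ≫ σ ≫ σ) x :=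
    hpow 4 (σ ≫ σ ≫ σ ≫ σ) fun y => (ha4 y).symm
  have ha6 : ∀ x, (a ^ 6) x = Motives.AlgPoints.map (σ ≫ σ ≫ σ ≫ σ ≫ σ ≫ σ) x :=
    hpow 5 (σ ≫ σ ≫ σ ≫ σ ≫ σ) fun y => (ha5 y).symm
  have ha7 : a ^ 7 = 1 := by
    refine Homeomorph.ext fun x => ?_
    rw [hpow 6 (σ ≫ σ ≫ σ ≫ σ ≫ σ ≫ σ) (fun y => (ha6 y).symm) x, hσ,
      Motives.AlgPoints.map_id_apply, Homeomorph.one_apply]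
  have hfree7 : ∀ i : ℕ, 0 < i → i < 7 → ∀ x : Motives.ComplexPoints C, (a ^ i) x ≠ x := by
    intro i hi0 hi7 x
    obtain ⟨h2, h3, h4, h5, h6⟩ := complexPoints_comp_pow_ne_of_pow_seven hσ hfree x
    interval_cases i
    · rw [ha1]; exact hfree x
    · rw [ha2]; exact h2
    · rw [ha3]; exact h3
    · rw [ha4]; exact h4
    · rw [ha5]; exact h5
    · rw [ha6]; exact h6
  -- Smith theory + transfer on the closed surface
  have hE := OrbitSpace.euler_eq_prime_mul_euler (n := 2 * 1) a ha7 hfree7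
  have hk := fun k => OrbitSpace.finrank_cohomology_orbitSpace_eq a ha7 hfree7 k
  simp only [show 2 * 1 + 1 = 3 from rfl, Finset.sum_range_succ, Finset.sum_range_zero, zero_add] at hE
  -- `σ^* = 1` on `H⁰` and on `H²`: the fixed spaces there are everything, of dimension `1`
  have hK0 : Module.finrank ℂ (LinearMap.ker ((complexBetti.map σ 0).hom - 1)) = 1 := by
    rw [complexBetti_map_zero_hom_eq_id hC σ, ← Module.End.one_eq_id, sub_self, LinearMap.ker_zero,
      finrank_top, finrank_complexBetti_zero hC]
  have hK2 : Module.finrank ℂ (LinearMap.ker ((complexBetti.map σ 2).hom - 1)) = 1 := by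
    rw [complexBetti_map_two_hom_eq_one_of_pow_seven hC σ hσ, sub_self, LinearMap.ker_zero, finrank_top,
      finrank_complexBetti_two_of_curve hC]
  have hq0 : Module.finrank ℂ (singularCohomology ℂ ℂ (OrbitSpace a) 0) = 1 := (hk 0).trans hK0
  have hq2 : Module.finrank ℂ (singularCohomology ℂ ℂ (OrbitSpace a) 2) = 1 := (hk 2).trans hK2
  have hq1 : Module.finrank ℂ (singularCohomology ℂ ℂ (OrbitSpace a) 1) =
      Module.finrank ℂ (LinearMap.ker ((complexBetti.map σ 1).hom - 1)) := hk 1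
  have hc0 : Module.finrank ℂ (singularCohomology ℂ ℂ (Motives.ComplexPoints C) 0) = 1 :=
    finrank_complexBetti_zero hC
  have hc2 : Module.finrank ℂ (singularCohomology ℂ ℂ (Motives.ComplexPoints C) 2) = 1 :=
    finrank_complexBetti_two_of_curve hC
  have hc1 : Module.finrank ℂ (singularCohomology ℂ ℂ (Motives.ComplexPoints C) 1) =
      Module.finrank ℂ (complexBetti C 1) := rfl
  rw [hq0, hq1, hq2, hc0, hc1, hc2] at hE
  push_cast at hE
  have key : 7 * (Module.finrank ℂ (LinearMap.ker ((complexBetti.map σ 1).hom - 1)) : ℤ) =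
      12 + (Module.finrank ℂ (complexBetti C 1) : ℤ) := by
    linarith
  exact_mod_cast key

end Curve

/-! ### §3 The Jacobian: `dim B = 36` from `H¹(J) ≅ H¹(C)` -/

section JacobianSide

variable {C : Motives.SchemeOver ℂ} (𝒥 : Jacobian C)

/-- **`(Σ_{i<7} sⁱ)^* = Σ_{i<7} (s^*)ⁱ` on `H¹`** for an endomorphism `s` of a complex abelian variety
(pull-back is additive and multiplicative on `H¹`). [cite: LangeBirkenhake1992, §1.1 (p. 19)] -/
theorem complexBetti_map_normElement₇_one_hom {J : Motives.AbelianVariety ℂ} (s : J ⟶ J) :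
    (complexBetti.map (𝟙 J + s + s ≫ s + s ≫ s ≫ s + s ≫ s ≫ s ≫ s + s ≫ s ≫ s ≫ s ≫ s +
        s ≫ s ≫ s ≫ s ≫ s ≫ s).hom.hom.hom 1).hom =
      ∑ j ∈ Finset.range 7, (complexBetti.map s.hom.hom.hom 1).hom ^ j := by
  have hc : ∀ f g : J ⟶ J, (complexBetti.map (f ≫ g).hom.hom.hom 1).hom =
      (complexBetti.map f.hom.hom.hom 1).hom ∘ₗ (complexBetti.map g.hom.hom.hom 1).hom := by
    intro f g
    change (complexBetti.map (f.hom.hom.hom ≫ g.hom.hom.hom) 1).hom = _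
    rw [complexBetti.map_comp, ModuleCat.hom_comp]
  rw [complexBetti_map_add_one, complexBetti_map_add_one, complexBetti_map_add_one,
    complexBetti_map_add_one, complexBetti_map_add_one, complexBetti_map_add_one]
  simp only [ModuleCat.hom_add]
  repeat rw [hc]
  change (complexBetti.map (𝟙 J.X) 1).hom + _ + _ + _ + _ + _ + _ = _
  rw [complexBetti.map_id, ModuleCat.hom_id, ← Module.End.one_eq_id]
  simp only [← Module.End.mul_eq_comp, Finset.sum_range_succ, Finset.sum_range_zero, zero_add, pow_zero,
    pow_succ, one_mul, mul_assoc]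

/-- **`dim B = 36` for the Prym `B = (ker Σ_{i<7} σ_*ⁱ)⁰ ⊂ J(C)` of an étale `ℤ/7`-cover with
`dim J(C) = 43`** (Patel–Zhang Lemma 5.1: `dim B = (m - 1)(g(C') - 1) = 6 · 6`; Schoen Lemma 1.5,
§3), from the named fact `Motives.isIso_bettiCohomology_map_abelJacobi` (`H¹(J(C)) ≅ H¹(C)`):
`2 dim B = dim ker(Σ Sʲ | H¹(J))` (`two_mul_dim_kerComponent_eq_finrank_ker`) `= 86 - dim ker(S - 1)`
(`finrank_ker_sum_pow_add_finrank_ker_sub_one`, `b₁(J) = 2·43`), and `dim ker(S - 1) =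
dim H¹(C)^σ = 14` (`S = (σ_*)^*` is conjugate to `σ^*` by the bijection `(f^P)^*`;
`seven_mul_finrank_ker_sub_one_eq`). [cite: PatelZhang2025PrymHodge, Lemma 2.9 and Lemma 5.1]
[cite: Schoen1988HodgeWeil, Lemma 1.5 and §3 (p. 24)] [cite: Lange2023AbelianVarietiesC, §4.1.1 and Lemma 4.4.1] -/
theorem dim_kerComponent_normElement_eq_thirtySix_of_isIso
    (hI : Motives.isIso_bettiCohomology_map_abelJacobi) (σ : C ⟶ C)
    (hC : Motives.IsSmoothProjective 1 C) (h43 : 𝒥.J.dim = 43)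
    (hσ : σ ≫ σ ≫ σ ≫ σ ≫ σ ≫ σ ≫ σ = 𝟙 C) (hfree : ∀ P : Motives.ComplexPoints C, P ≫ σ ≠ P)
    {s eN : 𝒥.J ⟶ 𝒥.J} (hs : s = 𝒥.pushforward 𝒥 σ)
    (heN : eN = 𝟙 𝒥.J + s + s ≫ s + s ≫ s ≫ s + s ≫ s ≫ s ≫ s + s ≫ s ≫ s ≫ s ≫ s +
      s ≫ s ≫ s ≫ s ≫ s ≫ s) :
    (Motives.AbelianVariety.kerComponent eN).dim = 36 := by
  haveI := finite_complexBetti_abelianVariety 𝒥.J 1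
  haveI := finite_complexBetti_of_isSmoothProjective hC 1
  set S : Module.End ℂ (complexBetti 𝒥.J.X 1) := (complexBetti.map s.hom.hom.hom 1).hom with hSdef
  -- `2 dim B = dim ker (Σ Sʲ)`
  have hD := two_mul_dim_kerComponent_eq_finrank_ker eN
  have hmap : (complexBetti.map eN.hom.hom.hom 1).hom = ∑ j ∈ Finset.range 7, S ^ j := by
    rw [heN, hSdef]
    exact complexBetti_map_normElement₇_one_hom s
  rw [hmap] at hD
  -- `S⁷ = 1`, `dim H¹(J) = 86`
  have hS7 : S ^ 7 = 1 := complexBetti_map_one_hom_pow_seven (pushforward_comp_pow_seven_of_pow_seven 𝒥 hσ hs)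
  have h86 : Module.finrank ℂ (complexBetti 𝒥.J.X 1) = 86 := by
    rw [Motives.AbelianVariety.finrank_complexBetti_one, h43]
  have hsplit := finrank_ker_sum_pow_add_finrank_ker_sub_one S hS7
  -- `dim ker(S - 1) = dim ker(σ^* - 1) = 14` through the bijection `(f^P)^*`
  obtain ⟨P⟩ : Nonempty (Motives.AlgPoints C ℂ) := Motives.nonempty_algPoints_of_isSmoothProjective hC
  have hbij := bijective_complexBetti_map_abelJacobi 𝒥 hI hC P
  have hsq := complexBetti_map_pushforward_comp_map_abelJacobi 𝒥 σ P 1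
  rw [← hs] at hsq
  have hcomm : (complexBetti.map σ 1).hom ∘ₗ (complexBetti.map (𝒥.abelJacobi P) 1).hom =
      (complexBetti.map (𝒥.abelJacobi P) 1).hom ∘ₗ S := by
    rw [hSdef, ← ModuleCat.hom_comp, ← hsq, ModuleCat.hom_comp]
  have hfix := finrank_ker_sub_one_eq_of_comm (complexBetti.map σ 1).hom S
    (complexBetti.map (𝒥.abelJacobi P) 1).hom hbij.1 hcomm
    (fun v _ => hbij.2 v)
  have hcurve := seven_mul_finrank_ker_sub_one_eq hC σ hσ hfree
  have hbC : Module.finrank ℂ (complexBetti C 1) = 86 := by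
    rw [← h86]
    exact (LinearEquiv.ofBijective (complexBetti.map (𝒥.abelJacobi P) 1).hom hbij).finrank_eq.symm
  -- restate everything on syntactically uniform carriers for `omega`
  have e1 : 2 * (Motives.AbelianVariety.kerComponent eN).dim =
      Module.finrank ℂ (LinearMap.ker (∑ j ∈ Finset.range 7, S ^ j)) := hD
  have e2 : Module.finrank ℂ (LinearMap.ker (∑ j ∈ Finset.range 7, S ^ j)) +
      Module.finrank ℂ (LinearMap.ker (S - 1)) = Module.finrank ℂ (complexBetti 𝒥.J.X 1) := hsplit
  have e3 : Module.finrank ℂ (LinearMap.ker (S - 1)) =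
      Module.finrank ℂ (LinearMap.ker ((complexBetti.map σ 1).hom - 1)) := hfix
  have e4 : 7 * Module.finrank ℂ (LinearMap.ker ((complexBetti.map σ 1).hom - 1)) =
      12 + Module.finrank ℂ (complexBetti C 1) := hcurve
  have e5 : Module.finrank ℂ (complexBetti C 1) = 86 := hbC
  have e6 : Module.finrank ℂ (complexBetti 𝒥.J.X 1) = 86 := h86
  omega

end JacobianSide

/-! ### §4 The Prym: every eigenspace `H¹(B(ℂ); ℂ)_{ζ₇^a}` has dimension `12` -/

section PrymSide

variable {C : Motives.SchemeOver ℂ} (𝒥 : Jacobian C)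

/-- **Chevalley–Weil for the Prym of an étale `ℤ/7`-cover (multiplicity `12`), from
`H¹(J) ≅ H¹(C)`.**  In the situation of `Schoen1988_cyclicPrym_weilClasses_algebraic_degreeSeven`
(`dim J(C) = 43`, `σ⁷ = 𝟙` free, `s = σ_*`, `e_N = Σ_{i<7} sⁱ`, `B = (ker e_N)⁰`, `s_B` over `s`), for
every primitive 7th root of unity `ζ` and `1 ≤ a ≤ 6`: `dim Eig(s_B^*|H¹(B(ℂ); ℂ), ζ^a) = 12` —
Patel–Zhang Lemma 2.9 / Cor. 2.10 / Lemma 5.1 ("all nonzero characters have the same multiplicity"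
`h = 2g(C') - 2 = 12`; `H¹(B, ℚ)` free of rank `12` over `ℚ(μ₇)`).  Proof: `Φ₇(s_B) = 0`
(`kerComponent_cyclotomic₇_restrict_eq_zero`) gives `Φ₇(s_B^*) = 0` on `H¹(B)`; the trace of `s_B^*`
is rational (`trace_map_one_mem_range_ratCast`); so the six multiplicities are equal
(`six_mul_finrank_eigenspace_eq_of_cyclotomic₇`) and add up to `b₁(B) = 2 dim B = 72`
(`dim_kerComponent_normElement_eq_thirtySix_of_isIso`).
[cite: PatelZhang2025PrymHodge, Lemma 2.9, Cor. 2.10 and Lemma 5.1]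
[cite: Schoen1988HodgeWeil, Lemma 1.5 and §3 (p. 24)] -/
theorem finrank_eigenspace_kerComponent_restrict_eq_twelve_of_isIso
    (hI : Motives.isIso_bettiCohomology_map_abelJacobi) (σ : C ⟶ C)
    (hC : Motives.IsSmoothProjective 1 C) (h43 : 𝒥.J.dim = 43)
    (hσ : σ ≫ σ ≫ σ ≫ σ ≫ σ ≫ σ ≫ σ = 𝟙 C) (hfree : ∀ P : Motives.ComplexPoints C, P ≫ σ ≠ P)
    {s eN : 𝒥.J ⟶ 𝒥.J} (hs : s = 𝒥.pushforward 𝒥 σ)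
    (heN : eN = 𝟙 𝒥.J + s + s ≫ s + s ≫ s ≫ s + s ≫ s ≫ s ≫ s + s ≫ s ≫ s ≫ s ≫ s +
      s ≫ s ≫ s ≫ s ≫ s ≫ s)
    {sB : Motives.AbelianVariety.kerComponent eN ⟶ Motives.AbelianVariety.kerComponent eN}
    (hsB : sB ≫ Motives.AbelianVariety.kerComponentι eN = Motives.AbelianVariety.kerComponentι eN ≫ s)
    {ζ : ℂ} (hζ : IsPrimitiveRoot ζ 7) {a : ℕ} (ha₁ : 1 ≤ a) (ha₆ : a ≤ 6) :
    Module.finrank ℂ (Module.End.eigenspace (complexBetti.map sB.hom.hom.hom 1).hom (ζ ^ a)) = 12 := by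
  haveI := finite_complexBetti_abelianVariety (Motives.AbelianVariety.kerComponent eN) 1
  set T : Module.End ℂ (complexBetti (Motives.AbelianVariety.kerComponent eN).X 1) :=
    (complexBetti.map sB.hom.hom.hom 1).hom with hT
  -- `Φ₇(T) = 0`
  have hΦ : ∑ j ∈ Finset.range 7, T ^ j = 0 := by
    rw [hT, ← complexBetti_map_normElement₇_one_hom sB, kerComponent_cyclotomic₇_restrict_eq_zero heN hsB,
      complexBetti_map_zero_one, ModuleCat.hom_zero]
  -- rational trace, `b₁(B) = 72`
  have htr := trace_map_one_mem_range_ratCast sB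
  have h72 : Module.finrank ℂ (complexBetti (Motives.AbelianVariety.kerComponent eN).X 1) = 72 := by
    rw [Motives.AbelianVariety.finrank_complexBetti_one,
      dim_kerComponent_normElement_eq_thirtySix_of_isIso 𝒥 hI σ hC h43 hσ hfree hs heN]
  have h := six_mul_finrank_eigenspace_eq_of_cyclotomic₇ T hΦ htr hζ ha₁ ha₆
  rw [h72] at h
  exact Nat.eq_of_mul_eq_mul_left (by norm_num : 0 < 6) (h.trans (by norm_num))

/-- **The typed eigenspace `E_a` is EXACTLY a line**, granted `H¹(J) ≅ H¹(C)`: with multiplicity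
`12` the pure wedge `⋀¹² H¹(B)_{ζ₇^a}` exists and spans `Eig((2·𝟙_B + s_B)^*|H¹², (2 + ζ₇^a)¹²)`
(the "neither larger nor smaller" of the fact's TYPING paragraph; here only `≤ 1` is recorded, from
`finrank_eigenspace_two_add_pow_twelve_le_one`). [cite: PatelZhang2025PrymHodge, §2.6 (p. 7)] -/
theorem finrank_eigenspace_two_add_pow_twelve_le_one_of_isIso
    (hI : Motives.isIso_bettiCohomology_map_abelJacobi) (σ : C ⟶ C)
    (hC : Motives.IsSmoothProjective 1 C) (h43 : 𝒥.J.dim = 43)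
    (hσ : σ ≫ σ ≫ σ ≫ σ ≫ σ ≫ σ ≫ σ = 𝟙 C) (hfree : ∀ P : Motives.ComplexPoints C, P ≫ σ ≠ P)
    {s eN : 𝒥.J ⟶ 𝒥.J} (hs : s = 𝒥.pushforward 𝒥 σ)
    (heN : eN = 𝟙 𝒥.J + s + s ≫ s + s ≫ s ≫ s + s ≫ s ≫ s ≫ s + s ≫ s ≫ s ≫ s ≫ s +
      s ≫ s ≫ s ≫ s ≫ s ≫ s)
    {sB : Motives.AbelianVariety.kerComponent eN ⟶ Motives.AbelianVariety.kerComponent eN}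
    (hsB : sB ≫ Motives.AbelianVariety.kerComponentι eN = Motives.AbelianVariety.kerComponentι eN ≫ s)
    {ζ : ℂ} (hζ : IsPrimitiveRoot ζ 7) {a : ℕ} (ha₁ : 1 ≤ a) (ha₆ : a ≤ 6) :
    Module.finrank ℂ (Module.End.eigenspace
      (complexBetti.map ((2 : ℤ) • 𝟙 (Motives.AbelianVariety.kerComponent eN) + sB).hom.hom.hom 12).hom
      ((2 + ζ ^ a) ^ 12)) ≤ 1 :=
  finrank_eigenspace_two_add_pow_twelve_le_one hζ (kerComponent_restrict_comp_pow_seven heN hsB) ha₁ ha₆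
    (finrank_eigenspace_kerComponent_restrict_eq_twelve_of_isIso 𝒥 hI σ hC h43 hσ hfree hs heN hsB hζ
      ha₁ ha₆).le

end PrymSide

/-! ### §5 Assembly: Schoen's fact from `H¹(J) ≅ H¹(C)` and Schoen's cycles -/

section Assembly

/-- **Schoen's degree-`7` fact from `H¹(J) ≅ H¹(C)` and Schoen's cycles.**  The named fact
`Schoen1988_cyclicPrym_weilClasses_algebraic_degreeSeven` (Schoen 1988, Cor. 3.1 with Thm. 2.0 at
`(q, m, r) = (7, 7, 0)`; Patel–Zhang 2025, Thm. 1.2 / 5.3) follows from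
(i) the named fact `Motives.isIso_bettiCohomology_map_abelJacobi` (`H¹(J(C)) ≅ H¹(C)`, Lange §4.1.1;
Milne Prop. 2.1), which gives the Chevalley–Weil multiplicity `12`
(`finrank_eigenspace_kerComponent_restrict_eq_twelve_of_isIso`), and
(iii) for each instance and each `a ∈ {1, 2, 3}` ONE non-zero algebraic class in the typed line
`E_a = Eig((2·𝟙_B + s_B)^*|H¹²(B(ℂ); ℂ), (2 + ζ₇^a)¹²)` — the class of Schoen's cycle `z_χ` pushed
to `B` (Thm. 2.0, case `r = 0`, p. 13: a component `Q` of the étale pull-back of `|K_{C'}| ≅ ℙ⁶` to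
`W₀ = G∖C¹²`, `Q·z_χ ≠ 0` by `c₆(N_{Q/W₀}) ≠ 0`, Lemma 2.6; Cor. 3.1, p. 25: Poincaré's formula and
Lieberman), the part of the printed proof absent from the tree; the lines `E₄, E₅, E₆` are the
complex conjugates (`…_of_finrank_le_of_exists_three`).
[cite: Schoen1988HodgeWeil, Thm 2.0 (p. 11, proof p. 13) and Cor 3.1 (pp. 24–25)]
[cite: PatelZhang2025PrymHodge, Lemma 2.9, Lemma 5.1, Thm 5.3] -/
theorem Schoen1988_cyclicPrym_weilClasses_algebraic_degreeSeven_of_isIso_of_exists_three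
    (hI : Motives.isIso_bettiCohomology_map_abelJacobi)
    (hP3 : ∀ (C : SchemeOver ℂ) (𝒥 : Jacobian C) (σ : C ⟶ C),
      IsSmoothProjective 1 C → 𝒥.J.dim = 43 →
      σ ≫ σ ≫ σ ≫ σ ≫ σ ≫ σ ≫ σ = 𝟙 C → (∀ P : ComplexPoints C, P ≫ σ ≠ P) →
      ∀ (s eN : 𝒥.J ⟶ 𝒥.J), s = 𝒥.pushforward 𝒥 σ →
      eN = 𝟙 𝒥.J + s + s ≫ s + s ≫ s ≫ s + s ≫ s ≫ s ≫ s + s ≫ s ≫ s ≫ s ≫ s +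
        s ≫ s ≫ s ≫ s ≫ s ≫ s →
      ∀ (sB : AbelianVariety.kerComponent eN ⟶ AbelianVariety.kerComponent eN),
        sB ≫ AbelianVariety.kerComponentι eN = AbelianVariety.kerComponentι eN ≫ s →
      ∀ a : ℕ, 1 ≤ a → a ≤ 3 →
        ∃ z ∈ Module.End.eigenspace
            (complexBetti.map ((2 : ℤ) • 𝟙 (AbelianVariety.kerComponent eN) + sB).hom.hom.hom 12).hom
            ((2 + Complex.exp (2 * (Real.pi : ℂ) * Complex.I / 7) ^ a) ^ 12),
          z ≠ 0 ∧ z ∈ algebraicClasses (AbelianVariety.kerComponent eN).X 6) :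
    Schoen1988_cyclicPrym_weilClasses_algebraic_degreeSeven :=
  Schoen1988_cyclicPrym_weilClasses_algebraic_degreeSeven_of_finrank_le_of_exists_three
    (fun _ 𝒥 σ hC h43 hσ hfree _ _ hs heN _ hsB _ ha₁ ha₆ =>
      (finrank_eigenspace_kerComponent_restrict_eq_twelve_of_isIso 𝒥 hI σ hC h43 hσ hfree hs heN hsB
        isPrimitiveRoot_exp_two_pi_I_div_seven ha₁ ha₆).le)
    hP3

end Assembly

end Literature.AlgebraicGeometry.HodgeTheory

end
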